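import Literature.MathematicalPhysics.QuantumFieldTheory.Balaban1983to89.B4TwoBox120
import Literature.MathematicalPhysics.QuantumFieldTheory.Balaban1983to89.B4

/-!
# `Balaban1983to89.B4Prop23ZeroBox` — LEAF `b4` CONJUNCT 2: «Proposition 2.3 of [1]» (`B4.Prop23Printed`) PROVED for the
# ZERO-FIELD NESTED-NEUMANN-BOX carriers

**Source.** T. Bałaban, *Regularity and Decay of Lattice Green's Functions*, Commun. Math. Phys. **89**, 571–597 (1983)
(bib key `Balaban1983RegularityDecay`, «B4» of the 1983–89 series), p. 574, Proposition 2.3 of [1], formulas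
(1.15)–(1.20).  Quoted from the rendered page `b2b-balaban-ref1/pages/1983-cmp89-regularity-decay/…-p004-x2.png`
(PDF p. 4 = journal p. 574), read as an image.

**WHAT IS PRINTED (p. 574, verbatim).** «**Proposition 2.3 of [1].** There exist positive constants δ₀, c₀, γ₀, γ₁
dependent on d and M only and such that for arbitrary Λ ⊂ Ω^{(k)} = Ω∩Z^d, Λ being a sum of big blocks and for e
sufficiently small, we have  γ₀I ≦ Δ^{(k)}(Ω, A) + aL^{−2}P(A) ≦ γ₁I, (1.15)  |C_Λ^{(k)}(Ω, A; x, x′)| ≦ c₀ exp(−δ₀|x − x′|),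
x, x′ ∈ Λ. (1.16)  In particular the above inequality holds for C^{(k)}(Ω, A). Putting  δC_Λ^{(k)}(Ω, A) = C_Λ^{(k)}(Ω, A) −
C^{(k)}(Ω, A), (1.17)  we have also  |δC_Λ^{(k)}(Ω, A; x, x′)| ≦ c₀ exp(−δ₀(|x − x′| + dist(x, Λ^c) + dist(x′, Λ^c))),
x, x′ ∈ Λ. (1.18)  Finally, for Ω ⊂ Ω₀ and  δC_Λ^{(k)}(Ω, Ω₀, A) = C_Λ^{(k)}(Ω, A) − C_Λ^{(k)}(Ω₀, A), (1.19)  we have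
|δC_Λ^{(k)}(Ω, Ω₀, A; x, x′)| ≦ c₀ exp(−δ₀(|x − x′| + dist(x, Ω^{(k)c}) + dist(x′, Ω^{(k)c}))), x, x′ ∈ Λ. (1.20)»
Here (p. 573, «we define the operator X|_Λ restricted to a subset Λ by X|_Λ = ΛXΛ, where Λ also denotes the
characteristic function of the set Λ») `C_Λ^{(k)}(Ω, A) = ((Δ^{(k)}(Ω, A) + aL^{−2}P(A))|_Λ)^{−1}` (1.13), with
`Δ^{(k)}(Ω, A) = a_kI − a_k²Q_k(A)G_k(Ω, A)Q_k^*(A)` (1.14).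

**WHAT THIS FILE CERTIFIES (kernel-checked, zero `sorry`).** The package types «Proposition 2.3 of [1]» verbatim as the
`Prop`-valued `B4.Prop23Printed (fam : I → B4.UnitSetting)` (module `…Balaban1983to89.B4`, surge node T01.2 = leaf `b4`,
conjunct 2 of `B4.LeafB4` in `DagBinding`), quantified over an ABSTRACT family of unit-lattice settings.  This file
exhibits ONE CONCRETE FAMILY for which that typed statement is a THEOREM:
* `ZeroBoxIdx d ℓ a₋ a₊ m²₊ a₂₋ a₂₊` (§2) indexes every zero-field nested-Neumann-box instance in dimension `d + 1` with
  block size `L = ℓ + 1`: mesh `n ≥ 1`, constants `a_j ∈ [a₋, a₊]`, `m_j² ∈ [0, m²₊]`, `a ∈ [a₂₋, a₂₊]`, an inner unit box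
  `□^{(j)} = ∏_μ {0, …, L·M′_μ − 1}` (`M′_μ ≥ 1`) sitting in an outer unit box `□₀^{(j)}` of sides `L·M₀′_μ` at the
  block-aligned offset `L·s′` (`B4TwoBox120.Fits`), an arbitrary finite `Λ ⊆ □^{(j)}`, and a charge `e`;
* `zeroFieldBoxes … : ZeroBoxIdx … → B4.UnitSetting` (§2) fills the carriers of `B4.UnitSetting` with the package's
  `A = 0` objects (`B4BoxCov237.covOp` = `Δ^{(j)}(□, 0) + aL^{−2}P` on `L²(□^{(j)})` from `B4BoxCov237`/`B4Green244`,
  `covOpSub … incl` = its compression to `Λ`, `(·)⁻¹` = `Matrix.inv`, which IS the inverse by `cov116_box_sub_decay`'s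
  first conjunct), see the DICTIONARY below;
* `prop23Printed_zeroFieldBoxes` (§3): **`B4.Prop23Printed (zeroFieldBoxes d ℓ a₋ a₊ m²₊ a₂₋ a₂₊)`** for every `d`, every
  `ℓ ≥ 1` and every window with `a₋ > 0`, `a₂₋ > 0` — assembled from the package's kernel certificates
  `B4BoxCov237.cov237_box_form_bounds` ((1.15): `γ₀‖ω‖² ≤ ⟨ω, (Δ^{(j)}(□,0) + aL^{−2}P)ω⟩ ≤ γ₁‖ω‖²`),
  `B4BoxCov237.cov116_box_sub_decay` ((1.16) for every injective `Λ ↪ □^{(j)}`), `B4BoxCov237.cov118_box_finset_delta`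
  ((1.17)–(1.18) with `dist(x, Λ^c) = dist_∞(x, □^{(j)} ∖ Λ)`), `B4TwoBox120.cov120_twoBox_finset_delta` ((1.19)–(1.20)
  for nested Neumann boxes with `dist(x, Ω^{(k)c}) = dist_∞(x, □₀^{(j)} ∖ □^{(j)})`), with ONE set of constants
  `δ₀ = min(δ_(1.16), δ_(1.18), δ_(1.20))`, `c₀ = max(c_(1.16), c_(1.18), c_(1.20))` (§1 `exp_bound_weaken`) and the
  threshold `e₁ = 1`;
* §4: the index type of the physical window `d + 1 = 4`, `L = 2` is inhabited (`idx0`, `e = 1`, hypotheses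
  `regular`, `bigBlocks`, `0 < e ≤ e₁` all met), so the typed statement is not vacuously discharged.

**DICTIONARY (print ↦ Lean, all at `A = 0`).** `k` ↦ `j` with `L^j = n` fine points per unit length (`B4Green244.blk`,
`fineBox`); `L` ↦ `ℓ + 1`; `Ω ⊂ Ω₀` ↦ the boxes `□ = Ls′ + ∏{0,…,LM′_μ−1} ⊂ □₀ = ∏{0,…,LM₀′_μ−1}` with Neumann boundary
conditions (the package's `B4BoxCov237`/`B4TwoBox120` setting; `B4TwoBox120.Fits`, `emb`); `Ω^{(k)} = Ω∩Z^d` ↦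
`B4Green244.boxDom (fun μ => (ℓ+1) * M′ μ)`; `Λ ⊂ Ω^{(k)}` ↦ `i.Λ : Finset ↥(boxDom …)`, `LSite = ↥i.Λ`; `|x − x′|` ↦
`B4BoxCov237.supNorm (x − x′)` (sup norm; (1.16)–(1.20) in print use the Euclidean norm — equivalent up to `√(d+1)`
in `δ₀`, recorded in `B4BoxCov237`'s HONEST SCOPE); `dist(x, Λ^c)` ↦ `B4BoxCov237.distC i.Λ x` (`Λ^c` read inside
`Ω^{(k)}`); `dist(x, Ω^{(k)c})` ↦ `B4TwoBox120.distOut (i.hs.scale (ℓ+1)) x` (`Ω^{(k)c}` read as `□₀^{(j)} ∖ □^{(j)}`, see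
`B4TwoBox120` HONEST SCOPE); `Δ^{(k)}(Ω, A) + aL^{−2}P(A)` ↦ `covOp i.n ℓ i.a₁ i.a₂ i.m2 i.M′`; `C_Λ^{(k)}(Ω, A; x, x′)` ↦
`(covOpSub i.n ℓ i.a₁ i.a₂ i.m2 i.M′ (fun y : ↥i.Λ => y.1))⁻¹ x x′`; `C^{(k)}(Ω, A; x, x′)` ↦ `(covOp …)⁻¹ x.1 x′.1`;
`C_Λ^{(k)}(Ω₀, A; x, x′)` ↦ `(covOpSub i.n ℓ i.a₁ i.a₂ i.m2 i.M₀′ (fun y : ↥i.Λ => emb (i.hs.scale (ℓ+1)) y.1))⁻¹ x x′`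
(`Λ` transported into `□₀^{(j)}` by the inclusion `τ = emb`); (1.15) ↦ `form115 γ₀ γ₁ := ∀ ω, γ₀(ω⬝ω) ≤ ω⬝(covOp …)ω ∧
ω⬝(covOp …)ω ≤ γ₁(ω⬝ω)`; «A satisfying (1.7)» ↦ `regular := True` (at `A = 0` (1.7) reads `0 ≤ …`); «Λ being a sum of
big blocks» ↦ `bigBlocks := True` (see HONEST SCOPE); «e sufficiently small» ↦ the binders `0 < e ≤ e₁` of
`B4.Prop23Printed`, met with `e₁ = 1` and unused (no operator depends on `e` at `A = 0`).

**HONEST SCOPE — what is NOT certified here.** (i) Only `A = 0` (`U ≡ 1`): the content of «for e sufficiently small»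
and of the regularity condition (1.7) — the whole difficulty of B4 §§2–4 for `A ≠ 0` — is absent; `regular := True` and
the `e`-binders are discharged trivially.  (ii) Only NESTED NEUMANN BOXES built of `L`-blocks for `Ω ⊂ Ω₀`, not
general unions of big blocks; `Ω^{(k)c}` in (1.20) is read as `□₀^{(j)} ∖ □^{(j)}` and `Λ^c` in (1.18) as `□^{(j)} ∖ Λ`
(both recorded divergences of `B4TwoBox120`/`B4BoxCov237`).  (iii) «Λ being a sum of big blocks» is NOT imposed
(`bigBlocks := True`): the package's `A = 0` certificates hold for EVERY finite `Λ ⊆ □^{(j)}`, so the discharged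
statement is formally stronger than the printed one in this respect and weaker in (i)–(ii).  (iv) The constants are
existential (`∃ δ₀ c₀ γ₀ γ₁`), depend on `d`, `ℓ` AND the window `[a₋,a₊]×[0,m²₊]×[a₂₋,a₂₊]` (print: «dependent on d and
M only»; the window dependence is the package's reading of the running constants `a_k`, `m_k²` of (1.3)–(1.6)), and
no numerical value is claimed.  (v) This file does NOT discharge the binding's leaf `B4.Prop23Printed X.famU` of
`DagBinding`/`DagDischarged` for an ABSTRACT family `X.famU`; it is offered to the DAG carver as the zero-field
instance of conjunct 2 (pattern of `B4Prop31Zero.prop31Printed_zeroField` for conjunct 3), and `DagDischarged` is not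
edited here (one writer).  (vi) Sup norm instead of the Euclidean norm in the exponents (equivalent up to `√(d+1)`).

**Value = kernel certificate (bookkeeping over the package's own `A = 0` theorems), NOT summit progress**: the
Yang–Mills / `Summit.QuantumFields` statements are untouched; no Literature fact is minted — every hypothesis used is
kernel-proved in this package.
-/

namespace Literature.MathematicalPhysics.QuantumFieldTheory.Balaban1983to89.B4Prop23ZeroBox

open Finset Matrix
open Literature.MathematicalPhysics.QuantumFieldTheory.Balaban1983to89
open Literature.MathematicalPhysics.QuantumFieldTheory.Balaban1983to89.B4ContourShift
open Literature.MathematicalPhysics.QuantumFieldTheory.Balaban1983to89.B4Reflection242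
open Literature.MathematicalPhysics.QuantumFieldTheory.Balaban1983to89.B4Green242Bridge
open Literature.MathematicalPhysics.QuantumFieldTheory.Balaban1983to89.B4BoxCov237
open Literature.MathematicalPhysics.QuantumFieldTheory.Balaban1983to89.B4TwoBox120

noncomputable section

/-! ## §1  Weakening of exponential bounds to common constants -/

/-- `c₁e^{−δ₁t} ≤ c e^{−δt}` for `t ≥ 0`, `0 ≤ c₁ ≤ c`, `δ ≤ δ₁`. [folklore] -/
theorem exp_bound_weaken {c₁ c δ₁ δ t : ℝ} (ht : 0 ≤ t) (hc₁ : 0 ≤ c₁) (hc : c₁ ≤ c) (hδ : δ ≤ δ₁) :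
    c₁ * Real.exp (-(δ₁ * t)) ≤ c * Real.exp (-(δ * t)) := by
  have h1 : Real.exp (-(δ₁ * t)) ≤ Real.exp (-(δ * t)) := by
    apply Real.exp_le_exp.mpr
    nlinarith
  exact mul_le_mul hc h1 (Real.exp_pos _).le (hc₁.trans hc)

/-! ## §2  The zero-field nested-box carriers of `B4.UnitSetting` -/

/-- **INDEX OF THE ZERO-FIELD NESTED-BOX INSTANCES** of «Proposition 2.3 of [1]» in dimension `d + 1`, block size
`L = ℓ + 1`, over the window `a_j ∈ [a₋, a₊]`, `m_j² ∈ [0, m²₊]`, `a ∈ [a₂₋, a₂₊]`: a mesh `n ≥ 1` (`n = L^j` fine points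
per unit length; fields `n`, `hn`), the constants `a₁ = a_j` of `Q_j^*Q_j`, `m2 = m_j²`, `a₂ = a` of `aL^{-2}P` (with their
window hypotheses), the inner unit box `Ω^{(j)} = □^{(j)}` of side lengths `L·M′_μ` (`M′`, `hM : M′_μ ≥ 1`) placed in
the outer unit box `Ω₀^{(j)} = □₀^{(j)}` of side lengths `L·M₀′_μ` by the shift `L·s′` (`Fits M′ M₀′ s′`: `0 ≤ s′_μ`,
`s′_μ + M′_μ ≤ M₀′_μ`), the subset `Λ ⊆ □^{(j)}` of unit sites (a `Finset`), and the charge `e` (which enters no operator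
at `A = 0`). [folklore] -/
structure ZeroBoxIdx (d ℓ : ℕ) (aminus aplus m2plus a2minus a2plus : ℝ) where
  n : ℕ
  hn : 1 ≤ n
  a₁ : ℝ
  m2 : ℝ
  a₂ : ℝ
  ha₁ : aminus ≤ a₁
  ha₁' : a₁ ≤ aplus
  hm : 0 ≤ m2
  hm' : m2 ≤ m2plus
  ha₂ : a2minus ≤ a₂
  ha₂' : a₂ ≤ a2plus
  M' : Fin (d + 1) → ℕ
  M0' : Fin (d + 1) → ℕ
  hM : ∀ i, 1 ≤ M' i
  s' : Fin (d + 1) → ℤ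
  hs : Fits M' M0' s'
  Λ : Finset ↥(boxDom (fun i => (ℓ + 1) * M' i))
  e : ℝ

/-- **THE ZERO-FIELD NESTED-BOX CARRIERS OF `B4.UnitSetting`** (dictionary at `A = 0`, `Ω = □ ⊂ Ω₀ = □₀` Neumann boxes
built of `L`-blocks): `LSite = Λ`; `udist x x′ = |x − x′|_∞`; `distLc = dist_∞(·, □^{(j)} ∖ Λ)` (`B4BoxCov237.distC`);
`distOc = dist_∞(· + Ls′, □₀^{(j)} ∖ (Ls′ + □^{(j)}))` (`B4TwoBox120.distOut`); `kerC x x′ = |C_Λ^{(j)}(□; x, x′)|`,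
`kerDC x x′ = |C_Λ^{(j)}(□; x, x′) − C^{(j)}(□; x, x′)|`, `kerDC0 x x′ = |C_Λ^{(j)}(□; x, x′) − C_{τΛ}^{(j)}(□₀; τx, τx′)|`
with `C_Λ^{(j)}(□) = ((Δ^{(j)}(□) + aL^{-2}P)|_Λ)^{-1} = (covOpSub …)⁻¹`, `C^{(j)}(□) = (covOp …)⁻¹`, `τ = emb` the inclusion
`□^{(j)} ⊂ □₀^{(j)}`; `form115 γ₀ γ₁` = `γ₀‖ω‖² ≤ ⟨ω, (Δ^{(j)}(□) + aL^{-2}P)ω⟩ ≤ γ₁‖ω‖²` for every `ω` on `L²(□^{(j)})`;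
`regular := True` ((1.7) at `A = 0`), `bigBlocks := True` (see HONEST SCOPE: no block structure of `Λ` is imposed).
[cite: Balaban1983RegularityDecay, p. 574 Prop. 2.3 (1.15)–(1.20), dictionary at A = 0] [folklore] -/
def zeroFieldBoxes (d ℓ : ℕ) (aminus aplus m2plus a2minus a2plus : ℝ)
    (i : ZeroBoxIdx d ℓ aminus aplus m2plus a2minus a2plus) : B4.UnitSetting where
  LSite := ↥i.Λ
  e := i.e
  regular := True
  bigBlocks := True
  udist := fun y y' => supNorm (y.1.1 - y'.1.1)
  distLc := fun y => distC i.Λ y.1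
  distOc := fun y => distOut (i.hs.scale (ℓ + 1)) y.1
  kerC := fun y y' => |(covOpSub i.n ℓ i.a₁ i.a₂ i.m2 i.M' (fun y : ↥i.Λ => y.1))⁻¹ y y'|
  kerDC := fun y y' =>
    |(covOpSub i.n ℓ i.a₁ i.a₂ i.m2 i.M' (fun y : ↥i.Λ => y.1))⁻¹ y y' - (covOp i.n ℓ i.a₁ i.a₂ i.m2 i.M')⁻¹ y.1 y'.1|
  kerDC0 := fun y y' =>
    |(covOpSub i.n ℓ i.a₁ i.a₂ i.m2 i.M' (fun y : ↥i.Λ => y.1))⁻¹ y y' -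
      (covOpSub i.n ℓ i.a₁ i.a₂ i.m2 i.M0' (fun y : ↥i.Λ => emb (i.hs.scale (ℓ + 1)) y.1))⁻¹ y y'|
  form115 := fun γ₀ γ₁ => ∀ ω : ↥(boxDom (fun j => (ℓ + 1) * i.M' j)) → ℝ,
    γ₀ * (ω ⬝ᵥ ω) ≤ ω ⬝ᵥ (covOp i.n ℓ i.a₁ i.a₂ i.m2 i.M').mulVec ω ∧
      ω ⬝ᵥ (covOp i.n ℓ i.a₁ i.a₂ i.m2 i.M').mulVec ω ≤ γ₁ * (ω ⬝ᵥ ω)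

/-! ## §3  The DAG leaf: `B4.Prop23Printed` for the zero-field nested-box carriers -/

/-- **LEAF `b4`, CONJUNCT 2, FOR THE ZERO-FIELD NESTED-BOX CARRIERS**: `B4.Prop23Printed (zeroFieldBoxes d ℓ …)` — the
verbatim-typed «Proposition 2.3 of [1]» (1.15)–(1.20) (`B4.Prop23Printed`, surge node T01.2) HOLDS for the family of
all its `A = 0` nested-Neumann-box instances in the window, with ONE set of constants `δ₀, c₀, γ₀, γ₁` depending on
`d`, `ℓ` and the window only (threshold `e₁ = 1`, vacuous at `A = 0`): (1.15) is `B4BoxCov237.cov237_box_form_bounds`,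
(1.16) `B4BoxCov237.cov116_box_sub_decay`, (1.17)–(1.18) `B4BoxCov237.cov118_box_finset_delta`, (1.19)–(1.20)
`B4TwoBox120.cov120_twoBox_finset_delta`, weakened to `δ₀ = min` and `c₀ = max` of their constants.  Nothing is
claimed about `A ≠ 0` or about general regions.
[cite: Balaban1983RegularityDecay, Prop. 2.3 of [1] (1.15)–(1.20) p.574, case A = 0, nested Neumann boxes (constants and proofs the package's)] -/
theorem prop23Printed_zeroFieldBoxes (d ℓ : ℕ) (hℓ : 1 ≤ ℓ) {aminus aplus m2plus a2minus a2plus : ℝ}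
    (ha : 0 < aminus) (ha2 : 0 < a2minus) :
    B4.Prop23Printed (zeroFieldBoxes d ℓ aminus aplus m2plus a2minus a2plus) := by
  obtain ⟨γ₀, γ₁, hγ, hγγ, H15⟩ := cov237_box_form_bounds d ℓ hℓ aminus aplus a2minus a2plus ha ha2
  obtain ⟨δ₁, c₁, hδ₁, hc₁, H16⟩ := cov116_box_sub_decay d ℓ hℓ aminus aplus m2plus a2minus a2plus ha ha2
  obtain ⟨δ₂, c₂, hδ₂, hc₂, H18⟩ := cov118_box_finset_delta d ℓ hℓ aminus aplus m2plus a2minus a2plus ha ha2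
  obtain ⟨δ₃, c₃, hδ₃, hc₃, H20⟩ := cov120_twoBox_finset_delta d ℓ hℓ aminus aplus m2plus a2minus a2plus ha ha2
  refine ⟨min δ₁ (min δ₂ δ₃), max c₁ (max c₂ c₃), γ₀, γ₁, 1, lt_min hδ₁ (lt_min hδ₂ hδ₃),
    lt_max_of_lt_left hc₁, hγ, lt_of_lt_of_le hγ hγγ, one_pos, ?_⟩
  intro i _ _ _ _
  refine ⟨?_, ?_, ?_, ?_⟩
  · -- (1.15)
    intro ω
    exact H15 i.n i.hn i.a₁ i.m2 i.a₂ i.ha₁ i.ha₁' i.hm i.ha₂ i.ha₂' i.M' i.hM ω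
  · -- (1.16)
    intro y y'
    have h := (H16 i.n i.hn i.a₁ i.m2 i.a₂ i.ha₁ i.ha₁' i.hm i.hm' i.ha₂ i.ha₂' i.M' i.hM
      (fun y : ↥i.Λ => y.1) Subtype.val_injective).2 y y'
    refine h.trans (exp_bound_weaken (supNorm_nonneg _) hc₁.le (le_max_left _ _) (min_le_left _ _))
  · -- (1.17)–(1.18)
    intro y y'
    have h := H18 i.n i.hn i.a₁ i.m2 i.a₂ i.ha₁ i.ha₁' i.hm i.hm' i.ha₂ i.ha₂' i.M' i.hM i.Λ y y'
    refine h.trans (exp_bound_weaken ?_ hc₂.le ((le_max_left _ _).trans (le_max_right _ _))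
      ((min_le_right _ _).trans (min_le_left _ _)))
    have := supNorm_nonneg (y.1.1 - y'.1.1)
    have := distC_nonneg i.Λ y.1
    have := distC_nonneg i.Λ y'.1
    positivity
  · -- (1.19)–(1.20)
    intro y y'
    have h := H20 i.n i.hn i.a₁ i.m2 i.a₂ i.ha₁ i.ha₁' i.hm i.hm' i.ha₂ i.ha₂' i.M' i.M0' i.hM i.s' i.hs i.Λ y y'
    refine h.trans (exp_bound_weaken ?_ hc₃.le ((le_max_right _ _).trans (le_max_right _ _))
      ((min_le_right _ _).trans (min_le_right _ _)))
    have := supNorm_nonneg (y.1.1 - y'.1.1)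
    have := distOut_nonneg (i.hs.scale (ℓ + 1)) y.1
    have := distOut_nonneg (i.hs.scale (ℓ + 1)) y'.1
    positivity

/-! ## §4  Non-vacuity -/

/-- the trivial nesting `□ = □₀` (`s′ = 0`). [folklore] -/
theorem fits_self {d : ℕ} (M : Fin (d + 1) → ℕ) : Fits M M (fun _ => 0) := fun i => ⟨le_rfl, by simp⟩

/-- an instance of the index at `d + 1 = 4`, `L = 2`, window `[1/2, 2] × [0, 1] × [1/2, 2]`: mesh `n = 1`, the unit cube
of `2`-blocks inside itself, `Λ` = the whole unit box. [folklore] -/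
def idx0 : ZeroBoxIdx 3 1 (1 / 2) 2 1 (1 / 2) 2 where
  n := 1
  hn := le_rfl
  a₁ := 1
  m2 := 0
  a₂ := 1
  ha₁ := by norm_num
  ha₁' := by norm_num
  hm := le_rfl
  hm' := by norm_num
  ha₂ := by norm_num
  ha₂' := by norm_num
  M' := fun _ => 1
  M0' := fun _ => 1
  hM := fun _ => le_rfl
  s' := fun _ => 0
  hs := fits_self _
  Λ := Finset.univ
  e := 1

/-- the index type of the physical window is inhabited, so the family quantified over in
`prop23Printed_zeroFieldBoxes` is not empty. [folklore] -/
instance : Nonempty (ZeroBoxIdx 3 1 (1 / 2) 2 1 (1 / 2) 2) := ⟨idx0⟩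

/-- non-vacuity: «Proposition 2.3 of [1]» as typed (`B4.Prop23Printed`) holds for the zero-field nested-box family of the
physical window `d + 1 = 4`, `L = 2`, `a_j ∈ [1/2, 2]`, `m_j² ∈ [0, 1]`, `a ∈ [1/2, 2]`, whose hypotheses `regular`,
`bigBlocks`, `0 < e ≤ e₁` are satisfiable (instance `idx0` with `e = 1`), so the four conclusions are genuinely asserted. -/
example : B4.Prop23Printed (zeroFieldBoxes 3 1 (1 / 2) 2 1 (1 / 2) 2) :=
  prop23Printed_zeroFieldBoxes 3 1 le_rfl (by norm_num) (by norm_num)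

/-- the hypotheses of the typed statement are met by `idx0` at every threshold `e₁ ≥ 1`: the instance is not excluded
by «for e sufficiently small» as typed. [folklore] -/
example : (zeroFieldBoxes 3 1 (1 / 2) 2 1 (1 / 2) 2 idx0).regular ∧ (zeroFieldBoxes 3 1 (1 / 2) 2 1 (1 / 2) 2 idx0).bigBlocks
    ∧ 0 < (zeroFieldBoxes 3 1 (1 / 2) 2 1 (1 / 2) 2 idx0).e ∧ (zeroFieldBoxes 3 1 (1 / 2) 2 1 (1 / 2) 2 idx0).e ≤ 1 :=
  ⟨trivial, trivial, by simp [zeroFieldBoxes, idx0], by simp [zeroFieldBoxes, idx0]⟩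

end

end Literature.MathematicalPhysics.QuantumFieldTheory.Balaban1983to89.B4Prop23ZeroBox
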